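import Summits.Langlands.Langlands.Theses.SqrtFiveQuarticCovers
import HarnessLib.Audit.CruxProbe

/-! BC7 deterministic crux probe for `RefinedLocusModular` (stmt-Langlands-17833), P1–P5 incl. C → S / S → C. -/

set_option h21.cruxProbe.batteryMs 90000 in
#h21_crux_probe Summit.Langlands.Langlands.Theses.SqrtFiveQuarticCovers.RefinedLocusModular summit := Langlands route := "route-Langlands-SqrtFiveQuarticCovers"
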